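import Mathlib.LinearAlgebra.Matrix.Charpoly.Eigs
import Mathlib.LinearAlgebra.Eigenspace.Minpoly
import Mathlib.FieldTheory.IsAlgClosed.Spectrum
import Mathlib.Analysis.Complex.Polynomial.Basic
import Mathlib.Analysis.Calculus.Deriv.Shift
import Mathlib.Data.Matrix.Block
import Literature.MathematicalPhysics.QuantumLattice.FinDimSpectrum
import Literature.MathematicalPhysics.KineticTheory.FouriersLaw
import HarnessLib

/-!
# Barrier (AtomisticToContinuum / FouriersLaw): the spectral gap of the boundary-driven chain closes as `N → ∞`

`Literature/Barriers/AtomisticToContinuum/` (D-0021 barrier catalogue). Sub-problem `FouriersLaw` =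
`Literature.MathematicalPhysics.KineticTheory.HeatConduction.FouriersLaw` (`Literature/MathematicalPhysics/KineticTheory/FouriersLaw.lean`):
for the pinned anharmonic chain `pinnedChain ω₂ lam β γ` between Langevin baths at the two ends,
`κ(T) = lim_N N · lim_{δT→0} J_N/δT` exists in `(0, ∞)`. This entry records the printed
obstruction to controlling the `N → ∞` limit through `N`-UNIFORM exponential relaxation RATES
(spectral gap, hypocoercive / entropic decay rates, mixing rates) of the `N`-site dynamics: with
friction on a bounded number of sites the spectral gap of the generator closes as `N → ∞`,
already for every harmonic chain — PROVED here as the matrix inequality it is in print, together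
with a PROVED bridge identifying the tree's harmonic Langevin generator with the corresponding
Ornstein–Uhlenbeck operator.

## The obstruction, as printed

* Becker–Menegaki 2022 (J. Funct. Anal. 282), §1.2: "The main motivation of this article is to
  find the exact scaling of the spectral gap of the associated generator of the dynamics … in
  terms of the number of the particles. … Attempts have been made through hypocoercive techniques
  to get `N`-dependent estimates under certain assumptions on the potentials: see the discussion
  in [Vil09, Section 9.2] where this question was first raised. The techniques discussed in
  Villani's monograph however only yield rather far from optimal estimates on the spectral gap in
  terms of the system size." Theorem 1: "Let the positive masses and interaction strengths of all
  oscillators coincide, `N` be the number of oscillators and `d` the dimension of the network.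
  Then if the sum of all friction parameters for all oscillators is uniformly bounded, the
  spectral gap of the chain of oscillators closes always as a function of `N`. In particular …
  (Homogeneous chain) … (1) when the two particles located at the corners … are exposed to
  non-zero friction and diffusion, the spectral gap of the generator satisfies
  `N^{-3d} ≲ λ_S ≲ N^{-3d}`. In particular for the one-dimensional chain we have
  `N^{-3} ≲ λ_S ≲ N^{-3}`. … (Chain with impurity) … the spectral gap `λ_S` of the generator
  closes exponentially fast in the number of oscillators, for all `d ≥ 1`. (Disordered chain) …
  if the pinning strengths are iid random variables according to some compactly supported density
  `ρ ∈ C_c(0, ∞)`, the spectral gap `λ_S` of the generator closes exponentially fast in the number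
  of oscillators, for all `d ≥ 1` for all but finitely many `N`." §2 (after Prop. 2.1, the
  Ornstein–Uhlenbeck theorem of Metafune–Pallara–Priola / Arnold–Erb / Monmarché: for
  `L f = -(Bx)·∇f + div(D∇f)` with `B` positively stable and no non-trivial `B^T`-invariant
  subspace of `ker D`, "both the exponential rate given by `ρ := inf{Re(λ) : λ ∈ Spec(B)}` … and
  the power `(1 + t^{2(m-1)})` are optimal"): "The spectral gap `λ_S` of the generator of the
  `N`-particle dynamics (2.1) is precisely given by" `inf {Re(λ) : λ ∈ Spec(M)}`. Proposition 2.2: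
  "(2) If there is the same non-zero friction at every oscillator … then the chain of oscillators
  has a spectral gap that is uniform in the number of oscillators. … (3) The spectral gap of the
  generator (1.3) closes at least with rate `O(N^{-1})` if the friction parameters at particles on
  the boundary" have bounded sum; proof of (3): "Since we have `2N^d` (counting multiplicity)
  positive terms that all satisfy `Re(λ) ≥ 0` where `λ ∈ Spec(M_{[N]^d})`, and by assumption
  `tr(Γ) = O(N^{d-1})`, we conclude that `λ_S = O(N^{-1})`". Remark 1: "The artificial case (2),
  in which we assume friction at every particle, and the result in (3) show that it is the
  sub-dimensionality of the particles experiencing friction that causes the spectral [gap] to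
  close for almost all configurations of the chain of oscillators."
* Menegaki 2020 (J. Stat. Phys. 181), §1.2, for the chain with Hamiltonian
  `H = ∑ (p_i²/2 + a q_i²/2 + U_pin(q_i)) + ∑ (c (q_{i+1} - q_i)²/2 + U_int(q_{i+1} - q_i)) + c q_1²/2 + c q_N²/2`,
  "the matrix `Γ` is the friction matrix `Γ = diag(γ, 0, ⋯, 0, γ)`", temperatures
  `Θ = diag(T_L, 0, …, 0, T_R)`, generator `L = -zM·∇_z - ∇_qΦ(q)·∇_p + ∇_p·ΓΘ∇_p`, `z = (p, q)`,
  "and `M` in blocks is the following `M = [[Γ, -I], [B, 0]]` where `I` is the identity matrix",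
  `B` the Jacobi matrix `tridiag(-c, a + 2c, -c)`. Abstract: "we obtain that the exponential
  rate, for the homogeneous chain, has order bigger than `N^{-3}`. For the purely harmonic chain
  the order of the rate is in `[N^{-3}, N^{-1}]`. This shows that, in this set up, the spectral
  gap decays at most polynomially with `N`." Theorem 1.2 (Wasserstein):
  `W_2(P_t^* f_0^1, P_t^* f_0^2) ≤ N^{3/2} e^{-(λ₀/N³)t} W_2(f_0^1, f_0^2)` provided the anharmonic
  perturbations satisfy `C_pin(N) + C_int(N) ≲ C₀/N⁶`; Theorem 1.4 (entropy): rate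
  `e^{-2κ₀N^{-6}t}`. Proposition 1.6: "the spectral gap of the harmonic chain `ρ` has a lower bound
  `ρ ≳ O(N^{-3})`", and p. 7: "This lower bound is in fact the optimal rate in the case of the
  harmonic homogeneous chain. In the work [BM19] it is proven that `ρ = O(N^{-3})` … in a
  disordered chain the spectral gap decays at an exponential rate in terms of `N`."
  Proposition 6.1: "The optimal order of the spectral gap of the dynamics … without the
  perturbing potentials, is given by the order of `ρ = inf{Re(μ) : μ ∈ σ(M)}`. The spectral gap
  approaches `0` as `N` goes to infinity, and the rate should be at least of order `O(1/N)`",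
  with the proof "`Tr(Γ) = Re(Tr(Γ)) = Re(Tr(M)) = ∑_{λ∈σ(M)} Re(λ)` … `≥ 2N inf{Re(λ) : λ ∈ σ(M)}`
  … which implies `inf{Re(λ) : λ ∈ σ(M)} ≤ C/(2N) = O(1/N)`". §2: "a curvature condition of the
  form `Γ₂(f,f) ≥ λΓ(f,f)` … implies a Log-Sobolev inequality (and thus Poincaré inequality)",
  but "the noise acts only on `2` out of `2N` variables of our phase space … we say that the
  particle system has `-∞` Bakry-Emery curvature". Remark 1.5: relative entropy and Wasserstein
  distances "behave good with the dimension, whereas `L²`-norm provides very bad, in `N`,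
  estimates" — for the prefactors.
* Villani 2009 (Hypocoercivity, Mem. AMS 202), §9.2 "Application to oscillator chains": the
  hypocoercivity theorem applies to the heat-conduction model as soon as "(a) the pinning
  potential `V_1` and the interaction potential `V_2` have bounded Hessians; (b) the Hessian of
  the interaction potential is bounded below by a positive constant; (c) the second derivatives
  of the logarithm of the stationary density are bounded; (d) the stationary measure satisfies a
  Poincaré inequality", and "it is a completely open problem to derive sufficient conditions for
  Assumptions (c) and (d), except in the simple case where the two temperatures of the model are
  equal."

## Contents (all PROVED; no named facts in this file)

* General complex matrices (dot-notation extensions of Mathlib's `Matrix`, stated for the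
  landed `Matrix.groundEnergy A = inf re σ(A)` of `QuantumLattice/FinDimSpectrum.lean`):
  `Matrix.card_mul_le_re_trace` (`card n · ρ ≤ Re tr A` for a common lower bound `ρ` of the real
  parts of the roots of the characteristic polynomial), `Matrix.groundEnergy_le_re`,
  `Matrix.le_groundEnergy`, `Matrix.exists_re_eq_groundEnergy`,
  `Matrix.card_mul_groundEnergy_le_re_trace`.
* `langevinDriftMatrix Γd B = [[diag Γd, -1], [B, 0]]` (Menegaki's `M`, blocks momenta ⊕
  positions), `trace_langevinDriftMatrix : tr M = ∑ γ_i`; `endFriction N γ` — friction `γ` on the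
  sites `0` and `N - 1` as in `OscillatorChain.generator`, `sum_endFriction : ∑ = 2γ`.
* `Menegaki2020_traceBound` — `2N ρ ≤ ∑_i γ_i` for every lower bound `ρ` of the real parts of the
  eigenvalues of `M`, every friction vector and EVERY real matrix `B` (Menegaki Prop. 6.1;
  BM Prop. 2.2 (3)); `two_mul_mul_groundEnergy_le_sum_friction` — the same for `ρ = λ_S(M)`.
* `BeckerMenegaki2022_gapClosing` — the headline: with friction `γ` at the two ends,
  `λ_S(M_N) = (cplx M_N).groundEnergy ≤ γ/N` for every `N ≥ 1` and every `B`; carries the BARRIER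
  block; `BeckerMenegaki2022_gapClosing.of_forall_le` — definition-free form.
* Bridge to the tree (`### The tree's harmonic chain is this Ornstein–Uhlenbeck process`):
  `partialQ_hamiltonian` — `∂_{q_i}H = U'(q_i) + V'(q_i - q_{i-1})[0<i] - V'(q_{i+1} - q_i)[i+1<N]`
  for every chain with differentiable potentials; `freeHarmonicHessian N ω₂` (`= ω₂·1 + Δ_free`,
  symmetric: `freeHarmonicHessian_isSymm`) with
  `partialQ_hamiltonian_pinnedChain_harmonic : ∂_{q_i}H = (B q)_i` for `pinnedChain ω₂ 0 0 γ`;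
  `generator_pinnedChain_harmonic` — the tree's `(pinnedChain ω₂ 0 0 γ).generator N T_L T_R` is
  the Ornstein–Uhlenbeck operator with drift `(p, -Bq - Γp)`, `Γ = diag(endFriction N γ)`, and
  diffusion `γ ∑_i ϑ_i ∂²_{p_i}`, `ϑ = endTemperature N T_L T_R`.

## Companion entry (audit 2026-08-15)

`Literature/Barriers/AtomisticToContinuum/SpectralGapClosingEquilibrium.lean` extends the obstruction beyond harmonic
chains: for EVERY `OscillatorChain` at equal bath temperatures the conserved bulk energy
(`L H_N = γ(T - p_0²) + γ(T - p_{N-1}²)`, proved there for all `U, V`) forces any `L²(Gibbs)`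
decay estimate with prefactor `C` to have rate `≤ 4√2 γ ln(2C)/√N` (`equilibrium_rate_bound`); the
BARRIER block below records the sharpened scope (harmonic member vs. the conjunct's `lam, β > 0`;
fixed-`N` results need coupling ≳ pinning [cite: CuneoEckmannHairerReyBellet2018, Thm 2.13], and fail for
pinning-dominated chains [cite: HairerMattingly2009, Thm 3.13]).

## Dictionary (why the matrix statement is the printed one, and what it covers in the tree)

By `generator_pinnedChain_harmonic` and `freeHarmonicHessian_isSymm`, for the harmonic member
`lam = β = 0` of `Literature.MathematicalPhysics.KineticTheory.HeatConduction.pinnedChain` the tree's generator is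
`-(M^T z)·∇_z + γ(T_L ∂²_{p_0} + T_R ∂²_{p_{N-1}})`, `z = (p, q)`,
`M = langevinDriftMatrix (endFriction N γ) (freeHarmonicHessian N ω₂)` (Menegaki's `-zM·∇_z` in
row-vector convention; `B^T = B`; `σ(M^T) = σ(M)`), i.e. an Ornstein–Uhlenbeck generator
`-(B̃x)·∇ + div(D∇·)` with `B̃ = M^T` in the notation of BM 2022 Prop. 2.1. Menegaki 2020 /
Rieder–Lebowitz–Lieb / Casher–Lebowitz use fixed walls (`B = tridiag(-c, a + 2c, -c)`),
Becker–Menegaki general masses, pinnings and impurities: the inequalities below hold for EVERY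
real `B`, so all these conventions, pinned or not (`ω₂ ≥ 0`), ordered or disordered, are covered.
The identification of `inf Re σ(M)` with the optimal exponential convergence rate of the
semigroup is the Ornstein–Uhlenbeck theorem quoted as BM 2022 Prop. 2.1 / Menegaki 2020 Prop. 6.1
(first part); it is not formalised here (no semigroup is built), exactly as the printed proofs
argue on `σ(M)` only.

## Design notes

* Eigenvalues "counting multiplicity" (BM Prop. 2.2 (3) proof) are the roots of the
  characteristic polynomial of the complexified matrix (`Matrix.charpoly`, `Polynomial.roots`,
  a multiset of cardinality `2N` since `ℂ` is algebraically closed); `tr = ∑ roots` is Mathlib's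
  `Matrix.trace_eq_sum_roots_charpoly`. The spectrum is the root SET
  (`Matrix.mem_spectrum_iff_isRoot_charpoly`; finite: `Matrix.finite_spectrum`; non-empty for a
  non-empty index type: `spectrum.nonempty_of_isAlgClosed_of_finiteDimensional`), and
  `λ_S = inf Re σ` is the landed `Matrix.groundEnergy` ("ground energy" of the drift matrix;
  junk `sInf ∅ = 0` for the `0 × 0` matrix, inherited).
* No positivity of `γ`, `B` or of the gap is needed for the inequality, and none is asserted:
  positive stability of `M` (`λ_S > 0`, [JPS17] in BM Prop. 2.2 (1)) is not used.
* The bridge differentiates the tree's `hamiltonian` through `Function.update` exactly as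
  `OscillatorChain.generator_hamiltonian` does for `∂_p`; `leftTerm`/`rightTerm` encode the
  free-end boundary (`i = 0` has no left, `i = N - 1` no right neighbour).
-/

noncomputable section

open Polynomial Complex Finset

/-! ### General complex matrices: trace bound and `inf re σ` -/

namespace Matrix

variable {n : Type*} [Fintype n] [DecidableEq n]

/-- (Dot-notation extension of Mathlib's `Matrix`.) For a complex square matrix `A`, a common
lower bound `ρ` of the real parts of the roots of the characteristic polynomial (the eigenvalues
counted with algebraic multiplicity) satisfies `card n · ρ ≤ Re tr A` — since `tr A = ∑ roots`
(`Matrix.trace_eq_sum_roots_charpoly`) and there are `card n` roots. The step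
"`∑_{λ∈σ(M)} Re λ ≥ 2N inf Re λ`" of Menegaki 2020, Prop. 6.1. [cite: Menegaki2020, Prop. 6.1 (proof)] -/
theorem card_mul_le_re_trace (A : Matrix n n ℂ) (ρ : ℝ) (h : ∀ μ ∈ A.charpoly.roots, ρ ≤ μ.re) :
    (Fintype.card n : ℝ) * ρ ≤ A.trace.re := by
  have hsplit : A.charpoly.Splits := IsAlgClosed.splits A.charpoly
  have hcard : Multiset.card A.charpoly.roots = Fintype.card n := by
    rw [← hsplit.natDegree_eq_card_roots, Matrix.charpoly_natDegree_eq_dim]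
  rw [Matrix.trace_eq_sum_roots_charpoly A, ← hcard]
  have hre : (A.charpoly.roots.sum).re = (A.charpoly.roots.map Complex.re).sum :=
    map_multiset_sum Complex.reAddGroupHom _
  rw [hre]
  have hle : Multiset.card (A.charpoly.roots.map Complex.re) • ρ ≤
      (A.charpoly.roots.map Complex.re).sum := by
    apply Multiset.card_nsmul_le_sum
    intro x hx
    obtain ⟨μ, hμ, rfl⟩ := Multiset.mem_map.mp hx
    exact h μ hμ
  rwa [Multiset.card_map, nsmul_eq_mul] at hle

/-- (Dot-notation extension of Mathlib's `Matrix`.) `inf re σ(A) ≤ Re μ` for every `μ ∈ σ(A)`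
(the spectrum of a matrix is finite, `Matrix.finite_spectrum`). [folklore] -/
theorem groundEnergy_le_re (A : Matrix n n ℂ) {μ : ℂ} (hμ : μ ∈ spectrum ℂ A) :
    A.groundEnergy ≤ μ.re := by
  rw [Matrix.groundEnergy, ContinuousLinearMap.groundEnergy, Matrix.spectrum_toEuclideanCLM]
  exact csInf_le ((Matrix.finite_spectrum A).image _).bddBelow ⟨μ, hμ, rfl⟩

/-- (Dot-notation extension of Mathlib's `Matrix`.) Every common lower bound of `re σ(A)` is
`≤ inf re σ(A)` when the index type is non-empty (the spectrum is then non-empty,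
`spectrum.nonempty_of_isAlgClosed_of_finiteDimensional`). [folklore] -/
theorem le_groundEnergy [Nonempty n] (A : Matrix n n ℂ) {ρ : ℝ}
    (h : ∀ μ ∈ spectrum ℂ A, ρ ≤ μ.re) : ρ ≤ A.groundEnergy := by
  rw [Matrix.groundEnergy, ContinuousLinearMap.groundEnergy, Matrix.spectrum_toEuclideanCLM]
  exact le_csInf ((spectrum.nonempty_of_isAlgClosed_of_finiteDimensional ℂ A).image _) (by
    rintro x ⟨μ, hμ, rfl⟩
    exact h μ hμ)

/-- (Dot-notation extension of Mathlib's `Matrix`.) `inf re σ(A)` is attained: it is the real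
part of some element of the spectrum (non-empty index type). [folklore] -/
theorem exists_re_eq_groundEnergy [Nonempty n] (A : Matrix n n ℂ) :
    ∃ μ ∈ spectrum ℂ A, μ.re = A.groundEnergy := by
  have hne : ((fun μ : ℂ => μ.re) '' spectrum ℂ A).Nonempty :=
    (spectrum.nonempty_of_isAlgClosed_of_finiteDimensional ℂ A).image _
  have hfin : ((fun μ : ℂ => μ.re) '' spectrum ℂ A).Finite := (Matrix.finite_spectrum A).image _
  obtain ⟨μ, hμ, hx⟩ := (Set.mem_image _ _ _).mp (hne.csInf_mem hfin)
  refine ⟨μ, hμ, ?_⟩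
  rw [hx, Matrix.groundEnergy, ContinuousLinearMap.groundEnergy, Matrix.spectrum_toEuclideanCLM]
  rfl

/-- (Dot-notation extension of Mathlib's `Matrix`.) The trace bound in spectral form:
`card n · inf re σ(A) ≤ Re tr A`. [cite: Menegaki2020, Prop. 6.1 (proof)] -/
theorem card_mul_groundEnergy_le_re_trace (A : Matrix n n ℂ) :
    (Fintype.card n : ℝ) * A.groundEnergy ≤ A.trace.re :=
  A.card_mul_le_re_trace _ fun _ hμ =>
    A.groundEnergy_le_re (Matrix.mem_spectrum_of_isRoot_charpoly (isRoot_of_mem_roots hμ))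

end Matrix

namespace Literature.Barriers.AtomisticToContinuum

/-! ### The drift matrix of the Langevin chain -/

/-- Menegaki's drift matrix `M = [[Γ, -I], [B, 0]]`, blocks indexed momenta ⊕ positions
(`z = (p, q)`), of the Langevin dynamics `dq = p dt`, `dp = -Bq dt - Γp dt + √(2ΓΘ) dW` of a
harmonic network with potential-energy Hessian `B` and friction matrix `Γ = diag(γ_i)`: the
generator is `-zM·∇_z + ∇_p·ΓΘ∇_p` (Menegaki 2020, §1.2: "and `M` in blocks is the following
`M = [[Γ, -I], [B, 0]]` where `I` is the identity matrix"). Here `B` is an arbitrary real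
`N × N` matrix (fixed walls, free ends, pinned or unpinned, ordered or disordered are all
instances; the tree's `pinnedChain ω₂ 0 0 γ` has `B = freeHarmonicHessian N ω₂`, see
`generator_pinnedChain_harmonic`). [cite: Menegaki2020, §1.2] -/
def langevinDriftMatrix {N : ℕ} (Γd : Fin N → ℝ) (B : Matrix (Fin N) (Fin N) ℝ) :
    Matrix (Fin N ⊕ Fin N) (Fin N ⊕ Fin N) ℝ :=
  Matrix.fromBlocks (Matrix.diagonal Γd) (-1) B 0

/-- `tr M = tr Γ = ∑_i γ_i` ("`Tr(Γ) = Re(Tr(M))`", Menegaki 2020, Prop. 6.1 proof).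
[cite: Menegaki2020, Prop. 6.1 (proof)] -/
theorem trace_langevinDriftMatrix {N : ℕ} (Γd : Fin N → ℝ) (B : Matrix (Fin N) (Fin N) ℝ) :
    (langevinDriftMatrix Γd B).trace = ∑ i, Γd i := by
  simp [langevinDriftMatrix, Matrix.trace, Fintype.sum_sum_type]

/-- Complexification of a real matrix (entrywise `ℝ → ℂ`), so that eigenvalues are counted over
`ℂ` as in print. [folklore] -/
abbrev cplx {m : Type*} (M : Matrix m m ℝ) : Matrix m m ℂ := M.map Complex.ofReal

/-- The complexified matrix has the same (real) trace. [folklore] -/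
theorem re_trace_cplx {m : Type*} [Fintype m] (M : Matrix m m ℝ) : (cplx M).trace.re = M.trace := by
  have : (cplx M).trace = Complex.ofRealHom M.trace :=
    (AddMonoidHom.map_trace (Complex.ofRealHom : ℝ →+* ℂ) M).symm
  rw [this]
  simp

/-- **Trace bound for the Langevin chain** (Menegaki 2020, Prop. 6.1, second part; Becker–
Menegaki 2022, Prop. 2.2 (3)): for EVERY friction vector `(γ_i)` and EVERY real matrix `B`,
a common lower bound `ρ` of the real parts of the `2N` eigenvalues (with multiplicity) of
`M = [[Γ, -I], [B, 0]]` satisfies `2N·ρ ≤ tr Γ = ∑_i γ_i`: "`Tr(Γ) = Re(Tr(Γ)) = Re(Tr(M)) =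
∑_{λ∈σ(M)} Re(λ)` … `≥ 2N inf{Re(λ) : λ ∈ σ(M)}`". PROVED. [cite: Menegaki2020, Prop. 6.1]
[cite: BeckerMenegaki2022, Prop. 2.2 (3)] -/
theorem Menegaki2020_traceBound {N : ℕ} (Γd : Fin N → ℝ) (B : Matrix (Fin N) (Fin N) ℝ) (ρ : ℝ)
    (h : ∀ μ ∈ (cplx (langevinDriftMatrix Γd B)).charpoly.roots, ρ ≤ μ.re) :
    2 * N * ρ ≤ ∑ i, Γd i := by
  have h1 := (cplx (langevinDriftMatrix Γd B)).card_mul_le_re_trace ρ h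
  rw [re_trace_cplx, trace_langevinDriftMatrix, Fintype.card_sum, Fintype.card_fin] at h1
  have : ((N + N : ℕ) : ℝ) = 2 * N := by push_cast; ring
  rwa [this] at h1

/-- The same with `ρ = λ_S(M) = inf Re σ(M)` (`Matrix.groundEnergy` of the complexified drift
matrix): `2N · λ_S(M) ≤ ∑_i γ_i` (so `λ_S = O(N^{-1})` when the total friction is bounded,
Becker–Menegaki Prop. 2.2 (3)). PROVED.
[cite: BeckerMenegaki2022, Prop. 2.2 (3)] [cite: Menegaki2020, Prop. 6.1] -/
theorem two_mul_mul_groundEnergy_le_sum_friction {N : ℕ} (Γd : Fin N → ℝ)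
    (B : Matrix (Fin N) (Fin N) ℝ) :
    2 * N * (cplx (langevinDriftMatrix Γd B)).groundEnergy ≤ ∑ i, Γd i :=
  Menegaki2020_traceBound Γd B _ fun _ hμ =>
    Matrix.groundEnergy_le_re _ (Matrix.mem_spectrum_of_isRoot_charpoly (isRoot_of_mem_roots hμ))

/-- Friction `γ` on the two end sites `0` and `N - 1` (both terms act on the single site when
`N = 1`), the friction profile of the tree's `OscillatorChain.generator` (baths at `i.val = 0`
and `i.val = N - 1`) and Menegaki's `Γ = diag(γ, 0, …, 0, γ)`.
[cite: Menegaki2020, §1.2 ("the matrix `Γ` is the friction matrix `Γ = diag(γ, 0, ⋯, 0, γ)`")] -/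
def endFriction (N : ℕ) (γ : ℝ) : Fin N → ℝ := fun i =>
  (if i.val = 0 then γ else 0) + (if i.val = N - 1 then γ else 0)

/-- Total friction of the two-bath chain: `∑_i γ_i = 2γ` for `N ≥ 1` — independent of `N`
("the `Tr(Γ)` does not depend on the number of oscillators", Menegaki 2020, Prop. 6.1 proof).
[cite: Menegaki2020, Prop. 6.1 (proof)] -/
theorem sum_endFriction {N : ℕ} (hN : 1 ≤ N) (γ : ℝ) : ∑ i, endFriction N γ i = 2 * γ := by
  have h0 : ∑ i : Fin N, (if i.val = 0 then γ else 0) = γ := by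
    have : ∀ i : Fin N, (if i.val = 0 then γ else 0) = if i = ⟨0, hN⟩ then γ else 0 := by
      intro i
      congr 1
      simp [Fin.ext_iff]
    simp_rw [this]
    simp
  have h1 : ∑ i : Fin N, (if i.val = N - 1 then γ else 0) = γ := by
    have : ∀ i : Fin N, (if i.val = N - 1 then γ else 0) =
        if i = ⟨N - 1, Nat.sub_lt hN one_pos⟩ then γ else 0 := by
      intro i
      congr 1
      simp [Fin.ext_iff]
    simp_rw [this]
    simp
  simp only [endFriction, Finset.sum_add_distrib, h0, h1]
  ring

/-- **The spectral gap of the boundary-driven harmonic chain closes as `N → ∞`** (Becker–Menegaki 2022, Theorem 1: "if the sum of all friction parameters for all oscillators is uniformly bounded, the spectral gap of the chain of oscillators closes always as a function of `N`"; Prop. 2.2 (3): "closes at least with rate `O(N^{-1})`"; Menegaki 2020, Prop. 6.1: "`inf{Re(λ) : λ ∈ σ(M)} ≤ C/(2N) = O(1/N)`"), PROVED in the explicit form: for every `N ≥ 1`, every `γ : ℝ` and EVERY real `N × N` matrix `B` (potential-energy Hessian: any pinning, coupling, masses `1`, boundary convention, disorder), `λ_S(M_N) = inf Re σ(M_N)`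 (the landed `Matrix.groundEnergy` of the complexified drift matrix `M_N = [[Γ, -I], [B, 0]]` with friction `Γ = diag(γ, 0, …, 0, γ)` at the two ends) satisfies `λ_S(M_N) ≤ γ/N` (from `2N·λ_S ≤ tr Γ = 2γ`). For the harmonic member `lam = β = 0` of `Literature.HeatConduction.pinnedChain ω₂ lam β γ` the Langevin generator of `FouriersLaw.lean` IS the Ornstein–Uhlenbeck operator `-(M_N^T z)·∇_z + γ(T_L∂²_{p_0} + T_R∂²_{p_{N-1}})` with `B = freeHarmonicHessian N ω₂ = B^T` (PROVED below: `generator_pinnedChain_harmonic`, `freeHarmonicHessian_isSymm`), whose optimal exponential rate of convergence to the steady state is `inf Re σ(M_N)` [cite: BeckerMenegaki2022, Prop. 2.1 and §2] [cite: Menegaki2020, Prop. 6.1] — that identification is quoted, not formalised.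
BARRIER (D-0021), AtomisticToContinuum/FouriersLaw:
technique_class: n-uniform-relaxation-rate n-uniform-l2-spectral-gap hypocoercive-rate entropic-bakry-emery-type-rate n-uniform-harris-lyapunov-mixing-rate (arguments that would control the `N → ∞` limit `D_N → κ(T)` in `OscillatorChain.FouriersLawFor` through a RATE of convergence to the non-equilibrium steady state of the `N`-site boundary-driven chain — `L²(μ)` spectral gap, hypocoercive `H¹`/Wasserstein rate, entropic (Bakry–Émery-type `Γ₂ ≥ λΓ`) rate, Harris/Lyapunov exponential mixing rate — that is UNIFORM in `N`; the quantitative programme raised in [cite: Villani2009, §9.2] and pursued in [cite: Menegaki2020, §1.2 and Thm 1.2] [cite: BeckerMenegaki2022, §1.2])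
blocks: `N`-uniform exponential relaxation for the chain with Langevin baths at the two ends (`OscillatorChain.generator`): for every harmonic network — hence for the harmonic member `lam = β = 0` of `pinnedChain`, pinned (`ω₂ > 0`) or not, free or fixed ends, ordered or disordered — `λ_S(N) = inf Re σ(M_N) ≤ γ/N → 0` (PROVED below); the sharp order is `N^{-3} ≲ λ_S ≲ N^{-3}` for the homogeneous pinned chain [cite: BeckerMenegaki2022, Thm 1 (1) and Prop. 3.2] [cite: Menegaki2020, Prop. 1.6 and p. 7], and the gap closes exponentially fast in `N` with a single impurity or iid disordered pinning [cite: BeckerMenegaki2022, Thm 1]; for WEAKLY ANHARMONIC chains the proved rates are `e^{-(λ₀/N³)t}` in Wasserstein distance and `e^{-2κ₀N^{-6}t}` in entropy, and only for anharmonic perturbations with `C_pin(N) + C_int(N) ≲ C₀/N⁶` [cite: Menegaki2020, Thm 1.2 and Thm 1.4]; for anharmonic chains whose coupling grows at infinity at least as fast as the pinning (condition C5 of [cite: CuneoEckmannHairerReyBellet2018, Thm 2.13]; Rey-Bellet–Thomas 2002, Carmona 2007, as reviewed in [cite: Menegaki2020, §1.1.2] [cite: BeckerMenegaki2022, §1.2])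 — the case of the conjunct's `pinnedChain ω₂ lam β γ`, `β > 0` — exponential convergence is known at each fixed `N`, in the weighted supremum norm with prefactor `C e^{θH_N(z)}` and with no control of the `N`-dependence of `C, c`; for PINNING-DOMINATED chains (homogeneous pinning `|q|^{2k}/2k` with `k > 3/2` and harmonic coupling — the `φ⁴` case `k = 2`, cf. `phi4Chain`) there is no spectral gap at ANY fixed `N`: the generator has essential spectrum at `0` for every chain of `≥ 5` oscillators, even at `T_L = T_R` [cite: HairerMattingly2009, Thm 3.13] ("in the articles [HM09, Hair09] some negative results are presented, i.e. lack of spectral gap, in cases where the pinning potential is stronger than the coupling one" [cite: BeckerMenegaki2022, §1.2]); and for EVERY chain (any `U, V`) at equal bath temperatures `T_L = T_R = T` an `L²(Gibbs)` decay estimate `‖P_t g‖ ≤ C e^{-λt}‖g‖` on the centred energy `g = H_N - ⟨H_N⟩` forces `λ ≤ 4√2 γ ln(2C)/√N`, because `L H_N = γ(T - p_0²) + γ(T - p_{N-1}²)` has `L²`-norm `2γT` while `‖g‖ ≥ T√(N/2)` — the conserved bulk energy leaves only through the two boundary momenta (companion entry `equilibrium_rate_bound` of `Literature/Barriers/AtomisticToContinuum/SpectralGapClosingEquilibrium.lean`,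 PROVED there as a normed-space inequality plus the generator identity; the transport bound printed for boundary-dissipated chains in [cite: Znidaric2015, §IV.A])
because: friction and noise act on `2` of the `2N` phase-space directions: `tr Γ = Re tr M_N = ∑_{λ∈σ(M_N)} Re λ ≥ 2N · inf Re λ` while `tr Γ = 2γ` does not grow with `N` (PROVED below as `Menegaki2020_traceBound`) [cite: Menegaki2020, Prop. 6.1 (proof)] [cite: BeckerMenegaki2022, Prop. 2.2 (3)]; "it is the sub-dimensionality of the particles experiencing friction that causes the spectral [gap] to close for almost all configurations of the chain of oscillators" [cite: BeckerMenegaki2022, Remark 1]; for the same reason the classical curvature route to rates fails: "the noise acts only on `2` out of `2N` variables of our phase space … we say that the particle system has `-∞` Bakry-Emery curvature" [cite: Menegaki2020, §2]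
evasions_known: (i) the same non-zero friction at EVERY oscillator gives a spectral gap uniform in `N` [cite: BeckerMenegaki2022, Prop. 2.2 (2)] — a bulk-thermostatted model, not the boundary-driven chain of `FouriersLaw`; (ii) extensive functionals (relative entropy, Wasserstein-2) control the `N`-dependence of the prefactors in front of the exponential, the rate itself still decays [cite: Menegaki2020, Remark 1.5 and Thm 1.2]; (iii) the hypotheses Villani's theorem would need on the steady state — bounded Hessian of the log-density, Poincaré inequality — are themselves open: "a completely open problem to derive sufficient conditions for Assumptions (c) and (d), except in the simple case where the two temperatures of the model are equal" [cite: Villani2009, §9.2]; none published giving `N`-uniform relaxation rates for a Hamiltonian bulk with baths on a bounded number of sites (audit 2026-08-15: none found; for boundary-dissipated chains the general expectation is the transport bound "relaxation can not happen in a time that grows with `L` slower than linearly" [cite: Znidaric2015, §IV.A], and strongly anharmonic / pinning-dominated chains relax slower, not faster [cite: HairerMattingly2009, Thm 3.13])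
scope_caveats: the inequality constrains the RATE of approach to the steady state, not the steady state, its current `J_N` or the response coefficients `D_N`: the harmonic chain has `λ_S ≤ γ/N → 0` together with a ballistic (size-independent) current, and "single impurities … should not affect the heat conductivity but do affect the spectral gap. Put differently, heat transport is an effect that is governed by all the modes of the system whereas the spectral gap is - in general - only determined by a single extremizing mode" [cite: BeckerMenegaki2022, §1.2] — so the entry blocks a technique (`N`-uniform rates), not Fourier's law itself; NOT blocked either are `N`-uniform functional inequalities (Poincaré, log-Sobolev) for the stationary measure ITSELF — they enter hypocoercivity as inputs, conditions (c)–(d) of [cite: Villani2009, §9.2], and in the equilibrium case `T_L = T_R` "the stationary measure is the Gibbs-Boltzmann measure `dμ = exp(-βH) dp dq`" [cite: Menegaki2020, §1.1.2], for the pinned harmonic chain a Gaussian with `N`-independent convexity `Hess H ≥ min(1, ω₂)` for which the curvature criterion "`Γ₂ ≥ λΓ` … implies a Log-Sobolev inequality (and thus Poincaré inequality)" of [cite: Menegaki2020, §2] holds for the reversible (overdamped) dynamics uniformly in `N`, while `BeckerMenegaki2022_gapClosing` (which does not involve `T_L, T_R`) still gives `λ_S ≤ γ/N`; the identification of `inf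 Re σ(M_N)` with the optimal exponential rate is the Ornstein–Uhlenbeck theorem quoted in [cite: BeckerMenegaki2022, Prop. 2.1] (Metafune–Pallara–Priola, Arnold–Erb, Monmarché) and concerns HARMONIC chains; for anharmonic chains no upper bound on the spectral gap is printed (listed as open: "the behavior of the spectral gap in terms of the dimension of the system … for nonlinear chains") [cite: BeckerMenegaki2022, §1.3 Open questions]; the harmonic member `lam = β = 0` is NOT an instance of the conjunct `FouriersLaw` (which takes `ω₂, lam, β, γ > 0`), so the proved matrix inequality reaches the conjunct's chains only as the statement that no rate bound can be uniform over a family of chains containing the harmonic one (e.g. bounds monotone or continuous in `lam, β ↓ 0`), while the model-independent obstruction for the anharmonic chains themselves is the equilibrium transport bound of the companion entry `equilibrium_rate_bound` (`SpectralGapClosingEquilibrium.lean`: rate `≤ 4√2 γ ln(2C)/√N` for prefactor `C`, at `T_L = T_R`) — it kills `N`-uniform (rate, prefactor) pairs in `L²(Gibbs)` and in relative entropy but not rates bought with prefactors `≥ e^{c√N}` (such as Lyapunov weights `e^{θH_N}` on extensive data), and the non-equilibrium `T_L ≠ T_R` version is expected, not proved (audit 2026-08-15); the Lean theorems are the matrix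 inequality and the identification of the generator as a differential operator — no semigroup, steady state or convergence rate is formalised
status: established
[cite: BeckerMenegaki2022, Thm 1 and Prop. 2.2 (3)] [cite: Menegaki2020, Prop. 6.1] -/
theorem BeckerMenegaki2022_gapClosing {N : ℕ} (hN : 1 ≤ N) (γ : ℝ) (B : Matrix (Fin N) (Fin N) ℝ) :
    (cplx (langevinDriftMatrix (endFriction N γ) B)).groundEnergy ≤ γ / N := by
  have h := two_mul_mul_groundEnergy_le_sum_friction (endFriction N γ) B
  rw [sum_endFriction hN] at h
  have hNpos : (0 : ℝ) < N := by exact_mod_cast hN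
  rw [le_div_iff₀ hNpos]
  nlinarith

/-- Definition-free form of the headline: with friction `γ` at the two ends, NO `ρ > γ/N` is a
common lower bound of the real parts of the spectrum of `M_N`, whatever `B` ("the spectral gap …
closes always as a function of `N`"). PROVED. [cite: BeckerMenegaki2022, Thm 1 and Prop. 2.2 (3)] -/
theorem BeckerMenegaki2022_gapClosing.of_forall_le {N : ℕ} (hN : 1 ≤ N) (γ : ℝ)
    (B : Matrix (Fin N) (Fin N) ℝ) {ρ : ℝ}
    (h : ∀ μ ∈ spectrum ℂ (cplx (langevinDriftMatrix (endFriction N γ) B)), ρ ≤ μ.re) :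
    ρ ≤ γ / N := by
  haveI : Nonempty (Fin N ⊕ Fin N) := ⟨Sum.inl ⟨0, hN⟩⟩
  exact (Matrix.le_groundEnergy _ h).trans (BeckerMenegaki2022_gapClosing hN γ B)

/-! ### The tree's harmonic chain is this Ornstein–Uhlenbeck process -/

open Literature.MathematicalPhysics.KineticTheory.HeatConduction

variable {N : ℕ}

/-- Left-neighbour term with the free-end convention: `leftTerm g q i = g(q_i - q_{i-1})` if
`0 < i`, else `0` (site `0` has no left neighbour). [folklore] -/
def leftTerm (g : ℝ → ℝ) (q : Fin N → ℝ) (i : Fin N) : ℝ :=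
  if h : 0 < i.val then g (q i - q ⟨i.val - 1, by omega⟩) else 0

/-- Right-neighbour term with the free-end convention: `rightTerm g q i = g(q_{i+1} - q_i)` if
`i + 1 < N`, else `0` (site `N - 1` has no right neighbour). [folklore] -/
def rightTerm (g : ℝ → ℝ) (q : Fin N → ℝ) (i : Fin N) : ℝ :=
  if h : i.val + 1 < N then g (q ⟨i.val + 1, h⟩ - q i) else 0

/-- The bond sum `∑_k [i = k + 1] g(q_i - q_k)` of the tree's double-sum Hamiltonian collapses
to `leftTerm`. [folklore] -/
theorem sum_ite_eq_leftTerm (g : ℝ → ℝ) (q : Fin N → ℝ) (i : Fin N) :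
    (∑ k : Fin N, if i.val = k.val + 1 then g (q i - q k) else 0) = leftTerm g q i := by
  unfold leftTerm
  split_ifs with h
  · rw [Finset.sum_eq_single ⟨i.val - 1, by omega⟩]
    · simp only
      rw [if_pos (by omega)]
    · intro k _ hk
      rw [if_neg]
      intro h'
      apply hk
      ext
      simp only
      omega
    · intro h'
      exact absurd (Finset.mem_univ _) h'
  · apply Finset.sum_eq_zero
    intro k _
    rw [if_neg (by omega)]

/-- The bond sum `∑_j [j = i + 1] g(q_j - q_i)` collapses to `rightTerm`. [folklore] -/
theorem sum_ite_eq_rightTerm (g : ℝ → ℝ) (q : Fin N → ℝ) (i : Fin N) :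
    (∑ j : Fin N, if j.val = i.val + 1 then g (q j - q i) else 0) = rightTerm g q i := by
  unfold rightTerm
  split_ifs with h
  · rw [Finset.sum_eq_single ⟨i.val + 1, h⟩]
    · simp
    · intro j _ hj
      rw [if_neg]
      intro h'
      apply hj
      ext
      simp only
      omega
    · intro h'
      exact absurd (Finset.mem_univ _) h'
  · apply Finset.sum_eq_zero
    intro j _
    rw [if_neg]
    intro h'
    exact h (h' ▸ j.isLt)

/-- **`∂_{q_i} H` for the tree's chain** with differentiable potentials (free ends, unit masses):
`∂_{q_i} H = U'(q_i) + V'(q_i - q_{i-1})·[0 < i] - V'(q_{i+1} - q_i)·[i + 1 < N]`, i.e. minus the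
force `F_i = -U'(q_i) + V'(q_{i+1} - q_i) - V'(q_i - q_{i-1})` of Bonetto–Lebowitz–Rey-Bellet's
equations of motion (their (10): `ṗ_i = -∇_{q_i} H` in the bulk) for `OscillatorChain.hamiltonian`.
PROVED by differentiating through `Function.update` as in `OscillatorChain.generator_hamiltonian`.
[cite: BonettoLebowitzReyBellet2000, §3 eq. (8) and §4.1 eq. (10)] -/
theorem partialQ_hamiltonian (P : OscillatorChain) (hU : Differentiable ℝ P.U)
    (hV : Differentiable ℝ P.V) (i : Fin N) (x : PhaseSpace N) :
    partialQ i (P.hamiltonian N) x =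
      deriv P.U (x.1 i) + leftTerm (deriv P.V) x.1 i - rightTerm (deriv P.V) x.1 i := by
  unfold partialQ OscillatorChain.hamiltonian
  -- the on-site sum
  have h1 : HasDerivAt (fun t : ℝ => ∑ k : Fin N, ((x.2 k) ^ 2 / 2 + P.U (Function.update x.1 i t k)))
      (∑ k : Fin N, if k = i then deriv P.U (x.1 i) else 0) (x.1 i) := by
    apply HasDerivAt.fun_sum
    intro k _
    by_cases hk : k = i
    · subst hk
      simp only [Function.update_self, if_true]
      exact ((hU (x.1 k)).hasDerivAt).const_add _
    · simp only [Function.update_of_ne hk, hk, if_false]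
      exact hasDerivAt_const _ _
  have h1' : (∑ k : Fin N, if k = i then deriv P.U (x.1 i) else 0) = deriv P.U (x.1 i) := by
    simp
  -- the bond double sum, summand `(k, j)`
  have h2 : HasDerivAt (fun t : ℝ => ∑ k : Fin N, ∑ j : Fin N,
        (if j.val = k.val + 1 then P.V (Function.update x.1 i t j - Function.update x.1 i t k)
          else 0))
      (∑ k : Fin N, ∑ j : Fin N,
        ((if j.val = k.val + 1 ∧ j = i then deriv P.V (x.1 j - x.1 k) else 0) -
          (if j.val = k.val + 1 ∧ k = i then deriv P.V (x.1 j - x.1 k) else 0))) (x.1 i) := by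
    apply HasDerivAt.fun_sum
    intro k _
    apply HasDerivAt.fun_sum
    intro j _
    by_cases hjk : j.val = k.val + 1
    · by_cases hji : j = i
      · have hki : k ≠ i := by
          intro h; rw [hji, h] at hjk; omega
        subst hji
        simp only [hjk, Function.update_self, Function.update_of_ne hki, true_and, if_true,
          hki, and_false, if_false, sub_zero]
        have hout : HasDerivAt P.V (deriv P.V (x.1 j - x.1 k)) (x.1 j - x.1 k) := (hV _).hasDerivAt
        simpa using hout.comp_sub_const (x.1 j) (x.1 k)
      · by_cases hki : k = i
        · subst hki
          simp only [hjk, Function.update_self, Function.update_of_ne hji, hji, and_false,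
            if_false, and_true, if_true, zero_sub]
          have hout : HasDerivAt P.V (deriv P.V (x.1 j - x.1 k)) (x.1 j - x.1 k) :=
            (hV _).hasDerivAt
          simpa using hout.comp_const_sub (x.1 j) (x.1 k)
        · simp only [hjk, Function.update_of_ne hji, Function.update_of_ne hki, hji, hki,
            and_false, if_false, sub_zero, if_true]
          exact hasDerivAt_const _ _
    · simp only [hjk, if_false, false_and, sub_zero]
      exact hasDerivAt_const _ _
  -- evaluate the double sum
  have h2' : (∑ k : Fin N, ∑ j : Fin N,
        ((if j.val = k.val + 1 ∧ j = i then deriv P.V (x.1 j - x.1 k) else 0) -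
          (if j.val = k.val + 1 ∧ k = i then deriv P.V (x.1 j - x.1 k) else 0))) =
      leftTerm (deriv P.V) x.1 i - rightTerm (deriv P.V) x.1 i := by
    simp only [Finset.sum_sub_distrib]
    congr 1
    · rw [← sum_ite_eq_leftTerm]
      refine Finset.sum_congr rfl fun k _ => ?_
      rw [Finset.sum_eq_single i]
      · by_cases h : i.val = k.val + 1
        · simp [h]
        · simp [h]
      · intro j _ hj
        simp [hj]
      · intro h; exact absurd (Finset.mem_univ _) h
    · rw [Finset.sum_comm, ← sum_ite_eq_rightTerm]
      refine Finset.sum_congr rfl fun j _ => ?_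
      rw [Finset.sum_eq_single i]
      · by_cases h : j.val = i.val + 1
        · simp [h]
        · simp [h]
      · intro k _ hk
        simp [hk]
      · intro h; exact absurd (Finset.mem_univ _) h
  rw [h1'] at h1
  rw [h2'] at h2
  have key : HasDerivAt (fun t : ℝ =>
      (∑ k : Fin N, ((x.2 k) ^ 2 / 2 + P.U (Function.update x.1 i t k))) +
        ∑ k : Fin N, ∑ j : Fin N,
          (if j.val = k.val + 1 then P.V (Function.update x.1 i t j - Function.update x.1 i t k)
            else 0))
      (deriv P.U (x.1 i) + (leftTerm (deriv P.V) x.1 i - rightTerm (deriv P.V) x.1 i)) (x.1 i) :=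
    h1.add h2
  dsimp only
  rw [key.deriv]
  ring

/-- The linear force map of the harmonic free-end chain,
`q ↦ (ω₂ q_i + (q_i - q_{i-1})·[0 < i] + (q_i - q_{i+1})·[i + 1 < N])_i = ∇_q H` for
`H = ∑ ω₂q_i²/2 + ∑_{bonds} (q_{i+1} - q_i)²/2`. [folklore] -/
def harmonicForce (N : ℕ) (ω₂ : ℝ) : (Fin N → ℝ) →ₗ[ℝ] (Fin N → ℝ) where
  toFun q i := ω₂ * q i + leftTerm (fun r => r) q i - rightTerm (fun r => r) q i
  map_add' q q' := by
    ext i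
    simp only [leftTerm, rightTerm, Pi.add_apply]
    split_ifs <;> ring
  map_smul' c q := by
    ext i
    simp only [leftTerm, rightTerm, Pi.smul_apply, smul_eq_mul, RingHom.id_apply]
    split_ifs <;> ring

/-- Unfolding `harmonicForce`. [folklore] -/
theorem harmonicForce_apply (ω₂ : ℝ) (q : Fin N → ℝ) (i : Fin N) :
    harmonicForce N ω₂ q i = ω₂ * q i + leftTerm (fun r => r) q i - rightTerm (fun r => r) q i :=
  rfl

/-- The potential-energy Hessian `B = ω₂·1 + Δ_free` of the harmonic free-end chain
(`Δ_free` the path-graph Laplacian, `(Δ_free q)_i = ∑_{j∼i} (q_i - q_j)`), as the matrix of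
`harmonicForce`. For the tree's `pinnedChain ω₂ 0 0 γ` this is `∇²_q H`
(`partialQ_hamiltonian_pinnedChain_harmonic`). [folklore] -/
def freeHarmonicHessian (N : ℕ) (ω₂ : ℝ) : Matrix (Fin N) (Fin N) ℝ :=
  LinearMap.toMatrix' (harmonicForce N ω₂)

/-- `B q = harmonicForce q`. [folklore] -/
theorem freeHarmonicHessian_mulVec (ω₂ : ℝ) (q : Fin N → ℝ) :
    (freeHarmonicHessian N ω₂).mulVec q = harmonicForce N ω₂ q :=
  LinearMap.toMatrix'_mulVec _ _

/-- Entries of the Hessian: `B i j = harmonicForce (e_j) i`. [folklore] -/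
theorem freeHarmonicHessian_apply (ω₂ : ℝ) (i j : Fin N) :
    freeHarmonicHessian N ω₂ i j = harmonicForce N ω₂ (Pi.single j 1) i := by
  rw [freeHarmonicHessian, LinearMap.toMatrix'_apply]

/-- The Hessian is a symmetric matrix (`B^T = B`, so that Menegaki's row-vector drift `-zM`
and the column-vector drift `-M^T z` involve the same `B`). [folklore] -/
theorem freeHarmonicHessian_isSymm (ω₂ : ℝ) : (freeHarmonicHessian N ω₂).IsSymm := by
  ext i j
  rw [Matrix.transpose_apply, freeHarmonicHessian_apply, freeHarmonicHessian_apply]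
  by_cases hij : i = j
  · subst hij; rfl
  · have hv : i.val ≠ j.val := fun h => hij (Fin.ext h)
    simp only [harmonicForce_apply, leftTerm, rightTerm, Pi.single_apply, Fin.ext_iff,
      hv, hv.symm, if_false, mul_zero, zero_add, zero_sub, sub_zero]
    split_ifs <;> (first | (exfalso; omega) | norm_num)

/-- The harmonic member of `pinnedChain`: `U(q) = ω₂ q²/2`. [folklore] -/
theorem pinnedChain_harmonic_U (ω₂ γ : ℝ) : (pinnedChain ω₂ 0 0 γ).U = fun q => ω₂ * q ^ 2 / 2 := by
  funext q; simp [pinnedChain]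

/-- The harmonic member of `pinnedChain`: `V(r) = r²/2`. [folklore] -/
theorem pinnedChain_harmonic_V (ω₂ γ : ℝ) : (pinnedChain ω₂ 0 0 γ).V = fun r => r ^ 2 / 2 := by
  funext r; simp [pinnedChain]

/-- `U'(q) = ω₂ q`. [folklore] -/
theorem deriv_pinnedChain_harmonic_U (ω₂ γ q : ℝ) : deriv (pinnedChain ω₂ 0 0 γ).U q = ω₂ * q := by
  rw [pinnedChain_harmonic_U]
  have h : HasDerivAt (fun q : ℝ => ω₂ * q ^ 2 / 2) (ω₂ * (2 * q) / 2) q := by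
    have := ((hasDerivAt_pow 2 q).const_mul ω₂).div_const 2
    simpa using this
  rw [h.deriv]; ring

/-- `V'(r) = r`. [folklore] -/
theorem deriv_pinnedChain_harmonic_V (ω₂ γ : ℝ) : deriv (pinnedChain ω₂ 0 0 γ).V = fun r => r := by
  rw [pinnedChain_harmonic_V]
  funext r
  have h : HasDerivAt (fun r : ℝ => r ^ 2 / 2) (2 * r / 2) r := by
    have := (hasDerivAt_pow 2 r).div_const 2
    simpa using this
  rw [h.deriv]; ring

/-- `U` is differentiable. [folklore] -/
theorem differentiable_pinnedChain_harmonic_U (ω₂ γ : ℝ) :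
    Differentiable ℝ (pinnedChain ω₂ 0 0 γ).U := by
  rw [pinnedChain_harmonic_U]; fun_prop

/-- `V` is differentiable. [folklore] -/
theorem differentiable_pinnedChain_harmonic_V (ω₂ γ : ℝ) :
    Differentiable ℝ (pinnedChain ω₂ 0 0 γ).V := by
  rw [pinnedChain_harmonic_V]; fun_prop

/-- **`∂_{q_i} H = (B q)_i`** for the harmonic member of `pinnedChain`, `B = freeHarmonicHessian N ω₂`.
PROVED. [folklore] -/
theorem partialQ_hamiltonian_pinnedChain_harmonic (ω₂ γ : ℝ) (i : Fin N) (x : PhaseSpace N) :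
    partialQ i ((pinnedChain ω₂ 0 0 γ).hamiltonian N) x =
      ((freeHarmonicHessian N ω₂).mulVec x.1) i := by
  rw [partialQ_hamiltonian _ (differentiable_pinnedChain_harmonic_U ω₂ γ)
    (differentiable_pinnedChain_harmonic_V ω₂ γ), deriv_pinnedChain_harmonic_U,
    deriv_pinnedChain_harmonic_V, freeHarmonicHessian_mulVec, harmonicForce_apply]

/-- Bath temperature profile `ϑ_i = T_L·[i = 0] + T_R·[i = N - 1]` of `OscillatorChain.generator`
(Menegaki's `Θ = diag(T_L, 0, …, 0, T_R)`; both terms on the single site when `N = 1`).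
[cite: Menegaki2020, §1.2] -/
def endTemperature (N : ℕ) (T_L T_R : ℝ) : Fin N → ℝ := fun i =>
  (if i.val = 0 then T_L else 0) + (if i.val = N - 1 then T_R else 0)

/-- **The tree's harmonic Langevin generator is the Ornstein–Uhlenbeck operator with drift matrix
`M = [[Γ, -I], [B, 0]]`**: for `P = pinnedChain ω₂ 0 0 γ` (harmonic pinning `ω₂q²/2`, harmonic
coupling, `lam = β = 0`), every `N`, `T_L`, `T_R`, every observable `f` and point `x = (q, p)`,
`(P.generator N T_L T_R f)(x) = ∑_i [ p_i ∂_{q_i} f - ((Bq)_i + γ_i p_i) ∂_{p_i} f ] + ∑_i γ ϑ_i ∂²_{p_i} f`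
with `B = freeHarmonicHessian N ω₂`, `γ_i = endFriction N γ i`, `ϑ_i = endTemperature N T_L T_R i`
— i.e. drift vector field `(q̇, ṗ) = (p, -Bq - Γp) = -M^T (p, q)` and diffusion `γΘ` on the
momenta, the operator `-zM·∇_z + ∇_p·ΓΘ∇_p` of Menegaki 2020 §1.2 (with her `B` replaced by the
free-end Hessian) to which the Ornstein–Uhlenbeck rate theorem of BM 2022 Prop. 2.1 refers.
PROVED (from `partialQ_hamiltonian_pinnedChain_harmonic`; no hypothesis on `f`, both sides use
the same `partialQ`/`partialP`). [cite: Menegaki2020, §1.2] [cite: BonettoLebowitzReyBellet2000, §4.1 eq. (10)] -/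
theorem generator_pinnedChain_harmonic (ω₂ γ T_L T_R : ℝ) (f : PhaseSpace N → ℝ)
    (x : PhaseSpace N) :
    (pinnedChain ω₂ 0 0 γ).generator N T_L T_R f x =
      (∑ i, (x.2 i * partialQ i f x
        - (((freeHarmonicHessian N ω₂).mulVec x.1) i + endFriction N γ i * x.2 i) * partialP i f x))
      + ∑ i, γ * endTemperature N T_L T_R i * partialP i (partialP i f) x := by
  simp only [OscillatorChain.generator, partialQ_hamiltonian_pinnedChain_harmonic,
    Finset.mul_sum, ← Finset.sum_add_distrib]
  refine Finset.sum_congr rfl fun i _ => ?_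
  simp only [endFriction, endTemperature, pinnedChain]
  split_ifs <;> ring

end Literature.Barriers.AtomisticToContinuum
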